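import Summits.ABC.ABC.Theorems.TwistAmplificationSharpModerateLawPlanarityFactorisationUniformReps

/-!
# Crux `TwistAmplification.SharpModerateLaw` (stmt-ABC-1975), line `unit-plane-conic-two-torsion`:
primes over the bad modulus, square-free bad ideals and `Cl[2]`-cosets for the lever
`stub_planarityFactorisationUniform`

Second helper file of the stub `stub_planarityFactorisationUniform : PlanarityFactorisationUniform`
(`…UnitPlaneFlat6Defs.lean` §3; after `…PlanarityFactorisationUniformReps.lean`: Minkowski representatives,
`#unitReps ≤ 8`).  The two remaining `F`-dependent ingredients of the landed `leverConst F` are repaired here,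
for an irreducible maximal `F`, `O = R(F)`, `M = badModulus F = 6·|a|·|Disc F|`:

* PRIMES OVER A RATIONAL PRIME (`card_primesAbove_le_three`): at most three prime ideals of `O` contain a prime
  `p` — each has norm `p^f ≥ p` and `∏_{𝔭 ∣ (p)} N𝔭^{e_𝔭} = N((p)) = p³`; hence at most `3·ω(M)` primes over `M`
  (`card_primesAbove_badModulus_le`) and at most `8^{ω(M)}` SQUARE-FREE BAD IDEALS `badSqfree F` (products of
  distinct primes over `M`), among which the datum's bad part `oddBadIdeal F u v` (`oddBadIdeal_mem_badSqfree`) —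
  this replaces the landed `badIdeals F` (ALL ideals of norm `≤ M³`);
* THE `Cl[2]`-COSET OF A CLASS EQUATION (`classesOver 𝔞 = {c : c² = [𝔞]}`, `card_classesOver_le`): at most
  `|Cl(O)[2]| = twoTorsionCard F` classes solve `c² = [𝔞]` (translate by a solution into the `2`-torsion), and
  the class `[𝔟]⁻¹` of a factorisation `(x) = 𝔞·𝔟²` is one of them (`inv_mk0_mem_classesOver`) — this replaces
  the factor `h = |Cl(O)|` of the landed shape index;
* the COUNT CONSTANT in `δ`-form (`exists_shapeCount_const`): `8·3^{ω(T)}·8^{ω(6A)} ≤ C(δ)·(A·T)^δ`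
  (divisor bound `6^{ω(n)} ≪_δ n^δ`, tree `exists_six_pow_card_primeFactors_le`).

Registered sub-goal proved here: `primesAbove_le_three` (at most three prime ideals of `R(F)` over a prime).
-/

noncomputable section

-- the mandated summit namespace `Summit.ABC.ABC` (summit = problem) trips the duplicate-namespace linter
set_option linter.dupNamespace false

namespace Summit.ABC.ABC.Theorems.SharpModerateLaw.UnitPlane

open Literature.NumberTheory.CubicFields
open RingOfForm (omega theta RatAlgebra)
open UniqueFactorizationMonoid (normalizedFactors)
open scoped nonZeroDivisors

section Bad

variable {F : BinaryCubic ℤ} [hF : Fact F.IsIrreducible] [hM : Fact (RingOfForm.IsMaximal F)]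

/-! ## 1. At most three primes of `R(F)` over a rational prime -/

open scoped Classical in
variable (F) in
/-- The prime ideals of `R(F)` over `n`: the distinct prime factors of the ideal `(n)` of `R(F)` (for a prime `n` this
is Mathlib's `IsDedekindDomain.primesOverFinset (Ideal.span {(n : ℤ)}) (RingOfForm F)` up to `factors`/`(n)ℤ·R(F)`
bookkeeping; it is used here for the COMPOSITE bad modulus, through `mem_primesAbove`). -/
def primesAbove (n : ℕ) : Finset (Ideal (RingOfForm F)) :=
  (normalizedFactors (Ideal.span {(n : RingOfForm F)})).toFinset

omit hF hM in
/-- `(n) ≠ ⊥` for `n ≠ 0`. -/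
theorem span_natCast_ne_bot {n : ℕ} (hn : n ≠ 0) : Ideal.span {(n : RingOfForm F)} ≠ ⊥ := by
  rw [Ne, Ideal.span_singleton_eq_bot]
  exact_mod_cast hn

/-- Membership in `primesAbove F n`: the prime ideals containing `n`. -/
theorem mem_primesAbove {n : ℕ} (hn : n ≠ 0) {P : Ideal (RingOfForm F)} :
    P ∈ primesAbove F n ↔ P.IsPrime ∧ (n : RingOfForm F) ∈ P := by
  classical
  rw [primesAbove, Multiset.mem_toFinset, Ideal.mem_normalizedFactors_iff (span_natCast_ne_bot hn),
    Ideal.span_singleton_le_iff_mem]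

/-- **At most three prime ideals of `R(F)` lie over a rational prime `p`**: in `N((p)) = p³ = ∏_{𝔭 ∣ (p)} N𝔭^{e_𝔭}`
every factor is `≥ p` (`N𝔭 = p^f`, `f, e_𝔭 ≥ 1`), so `p^{#} ≤ p³` (the case `[K_F : ℚ] = 3` of `Σ e·f = n`, Mathlib's
`Ideal.card_primesOverFinset_le_finrank`; the norm count avoids assembling the `IsFractionRing`/scalar-tower instances of
`ℤ ⊂ R(F) ⊂ K_F` that lemma consumes). -/
theorem card_primesAbove_le_three {p : ℕ} (hp : p.Prime) : (primesAbove F p).card ≤ 3 := by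
  classical
  set I := Ideal.span {(p : RingOfForm F)} with hI_def
  have hI : I ≠ ⊥ := span_natCast_ne_bot hp.ne_zero
  have hNI : Ideal.absNorm I = p ^ 3 := by rw [hI_def, Ideal.absNorm_span_natCast, RingOfForm.finrank_eq_three]
  have hprod : p ^ 3 = ∏ P ∈ primesAbove F p, Ideal.absNorm P ^ (normalizedFactors I).count P := by
    have h := congrArg Ideal.absNorm (Ideal.prod_normalizedFactors_eq_self hI)
    rw [Finset.prod_multiset_count, map_prod, hNI] at h
    simp_rw [map_pow] at h
    exact h.symm
  have hge : ∀ P ∈ primesAbove F p, p ≤ Ideal.absNorm P ^ (normalizedFactors I).count P := by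
    intro P hP
    obtain ⟨hPp, hpP⟩ := (mem_primesAbove hp.ne_zero).mp hP
    have hcount : 1 ≤ (normalizedFactors I).count P := Multiset.one_le_count_iff_mem.mpr (Multiset.mem_toFinset.mp hP)
    have hN : p ≤ Ideal.absNorm P := by
      have hdvd : Ideal.absNorm P ∣ p ^ 3 := by
        rw [← hNI]; exact Ideal.absNorm_dvd_absNorm_of_le ((Ideal.span_singleton_le_iff_mem _).mpr hpP)
      obtain ⟨k, -, hk⟩ := (Nat.dvd_prime_pow hp).mp hdvd
      have hne1 : Ideal.absNorm P ≠ 1 := by rw [Ne, Ideal.absNorm_eq_one_iff]; exact hPp.ne_top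
      rw [hk] at hne1 ⊢
      have hk0 : k ≠ 0 := fun h => hne1 (by rw [h, pow_zero])
      calc p = p ^ 1 := (pow_one p).symm
        _ ≤ p ^ k := Nat.pow_le_pow_right hp.pos (Nat.one_le_iff_ne_zero.mpr hk0)
    calc p ≤ Ideal.absNorm P ^ 1 := by rwa [pow_one]
      _ ≤ Ideal.absNorm P ^ (normalizedFactors I).count P := Nat.pow_le_pow_right (hp.pos.trans_le hN) hcount
  have hle : p ^ (primesAbove F p).card ≤ p ^ 3 := by
    rw [hprod]; exact Finset.pow_card_le_prod _ _ _ hge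
  exact (Nat.pow_le_pow_iff_right hp.one_lt).mp hle

/-- **At most `3·ω(M)` primes of `R(F)` over the bad modulus**: a prime ideal containing `M = ∏ p^{v_p}` contains
one of the `p`. -/
theorem card_primesAbove_badModulus_le :
    (primesAbove F (badModulus F)).card ≤ 3 * (badModulus F).primeFactors.card := by
  classical
  have hM0 := badModulus_ne_zero hF.out
  have hsub : primesAbove F (badModulus F) ⊆ (badModulus F).primeFactors.biUnion fun p => primesAbove F p := by
    intro P hP
    obtain ⟨hPp, hMP⟩ := (mem_primesAbove hM0).mp hP
    have hfact : ((badModulus F : ℕ) : RingOfForm F) =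
        ∏ p ∈ (badModulus F).primeFactors, (p : RingOfForm F) ^ (badModulus F).factorization p := by
      conv_lhs => rw [← Nat.prod_factorization_pow_eq_self hM0]
      rw [Finsupp.prod, Nat.support_factorization, Nat.cast_prod]
      simp_rw [Nat.cast_pow]
    rw [hfact] at hMP
    obtain ⟨p, hp, hpP⟩ := (Ideal.IsPrime.prod_mem_iff (hp := hPp)).mp hMP
    exact Finset.mem_biUnion.mpr
      ⟨p, hp, (mem_primesAbove (Nat.prime_of_mem_primeFactors hp).ne_zero).mpr ⟨hPp, hPp.mem_of_pow_mem _ hpP⟩⟩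
  calc (primesAbove F (badModulus F)).card
      ≤ ((badModulus F).primeFactors.biUnion fun p => primesAbove F p).card := Finset.card_le_card hsub
    _ ≤ ∑ p ∈ (badModulus F).primeFactors, (primesAbove F p).card := Finset.card_biUnion_le
    _ ≤ ∑ _p ∈ (badModulus F).primeFactors, 3 :=
        Finset.sum_le_sum fun p hp => card_primesAbove_le_three (Nat.prime_of_mem_primeFactors hp)
    _ = 3 * (badModulus F).primeFactors.card := by rw [Finset.sum_const, smul_eq_mul, mul_comm]

/-! ## 2. Square-free bad ideals -/

variable (F) in
/-- The SQUARE-FREE BAD IDEALS: products of distinct prime ideals over `M = 6·|a|·|Disc F|`. -/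
def badSqfree : Finset (Ideal (RingOfForm F)) :=
  (primesAbove F (badModulus F)).powerset.image fun s => ∏ P ∈ s, P

/-- **`#badSqfree F ≤ 8^{ω(M)}`** (`2^{#primes over M}`, `#primes over M ≤ 3ω(M)`). -/
theorem card_badSqfree_le : (badSqfree F).card ≤ 8 ^ (badModulus F).primeFactors.card := by
  calc (badSqfree F).card ≤ (primesAbove F (badModulus F)).powerset.card := Finset.card_image_le
    _ = 2 ^ (primesAbove F (badModulus F)).card := Finset.card_powerset _
    _ ≤ 2 ^ (3 * (badModulus F).primeFactors.card) := Nat.pow_le_pow_right two_pos card_primesAbove_badModulus_le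
    _ = 8 ^ (badModulus F).primeFactors.card := by rw [pow_mul]; norm_num

/-- **The datum's bad part is a square-free bad ideal**: `oddBadIdeal F u v` is the product of the DISTINCT
odd-exponent primes of `(a u + v ω)` of norm not prime to `M`, each of which divides `(M)` (`oddBadIdeal_dvd_span`). -/
theorem oddBadIdeal_mem_badSqfree {u v : ℤ} (h0 : F.eval u v ≠ 0) : oddBadIdeal F u v ∈ badSqfree F := by
  classical
  unfold badSqfree oddBadIdeal
  refine Finset.mem_image.mpr ⟨_, ?_, rfl⟩
  rw [Finset.mem_powerset]
  intro P hP
  have hPf := (Finset.mem_filter.mp hP).1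
  obtain ⟨hPp, -, -⟩ := isPrime_of_mem_planeFactors (Multiset.mem_toFinset.mp hPf) h0
  have hdvd : P ∣ oddBadIdeal F u v := Finset.dvd_prod_of_mem (fun P : Ideal (RingOfForm F) => P) hP
  have hM : (badModulus F : RingOfForm F) ∈ P := Ideal.dvd_span_singleton.mp (hdvd.trans (oddBadIdeal_dvd_span h0))
  exact (mem_primesAbove (badModulus_ne_zero hF.out)).mpr ⟨hPp, hM⟩

/-! ## 3. The classes solving `c² = [𝔞]`: a coset of `Cl(O)[2]` -/

open scoped Classical in
/-- The classes `c` with `c² = [𝔞]` (empty for `𝔞 = 0`). -/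
def classesOver (𝔞 : Ideal (RingOfForm F)) : Finset (ClassGroup (RingOfForm F)) :=
  if h : 𝔞 ∈ (Ideal (RingOfForm F))⁰ then Finset.univ.filter fun c => c ^ 2 = ClassGroup.mk0 ⟨𝔞, h⟩ else ∅

/-- `twoTorsionCard F = #{c : c² = 1}` as a finite-set count (aligning the instance inside `twoTorsionCard`). -/
theorem twoTorsionCard_eq_card_filter [DecidablePred fun c : ClassGroup (RingOfForm F) => c ^ 2 = 1] :
    twoTorsionCard F = (Finset.univ.filter fun c : ClassGroup (RingOfForm F) => c ^ 2 = 1).card := by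
  unfold twoTorsionCard
  rw [dif_pos hF.out, ← Fintype.card_subtype, Nat.card_eq_fintype_card]

/-- **At most `|Cl(O)[2]|` classes solve `c² = [𝔞]`**: translating by one solution embeds them in the `2`-torsion. -/
theorem card_classesOver_le (𝔞 : Ideal (RingOfForm F)) : (classesOver 𝔞).card ≤ twoTorsionCard F := by
  classical
  unfold classesOver
  split_ifs with h𝔞
  · set x := ClassGroup.mk0 ⟨𝔞, h𝔞⟩
    by_cases hne : (Finset.univ.filter fun c : ClassGroup (RingOfForm F) => c ^ 2 = x).Nonempty
    · obtain ⟨c₀, hc₀⟩ := hne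
      have hc₀' : c₀ ^ 2 = x := (Finset.mem_filter.mp hc₀).2
      rw [twoTorsionCard_eq_card_filter]
      refine Finset.card_le_card_of_injOn (fun c => c * c₀⁻¹) (fun c hc => ?_) fun c₁ _ c₂ _ h => mul_right_cancel h
      have hc' : c ^ 2 = x := (Finset.mem_filter.mp hc).2
      simp only [Finset.coe_filter, Finset.mem_univ, true_and, Set.mem_setOf_eq]
      rw [mul_pow, inv_pow, hc', hc₀', mul_inv_cancel]
    · rw [Finset.not_nonempty_iff_eq_empty.mp hne, Finset.card_empty]
      exact Nat.zero_le _
  · rw [Finset.card_empty]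
    exact Nat.zero_le _

/-- **The class of a factorisation `(x) = 𝔞·𝔟²` lies in the coset**: `[𝔟]⁻¹ ∈ classesOver 𝔞` (`[𝔞]·[𝔟]² = 1`). -/
theorem inv_mk0_mem_classesOver {𝔞 𝔟 : Ideal (RingOfForm F)} (h𝔟 : 𝔟 ∈ (Ideal (RingOfForm F))⁰) {x : RingOfForm F}
    (hx : x ≠ 0) (h : Ideal.span {x} = 𝔞 * 𝔟 ^ 2) : (ClassGroup.mk0 ⟨𝔟, h𝔟⟩)⁻¹ ∈ classesOver 𝔞 := by
  classical
  have hsx : Ideal.span {x} ∈ (Ideal (RingOfForm F))⁰ :=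
    mem_nonZeroDivisors_of_ne_zero (by rw [Ideal.zero_eq_bot, Ne, Ideal.span_singleton_eq_bot]; exact hx)
  have h𝔞 : 𝔞 ∈ (Ideal (RingOfForm F))⁰ := by
    refine mem_nonZeroDivisors_of_ne_zero fun h0 => ?_
    rw [h0, zero_mul] at h
    exact nonZeroDivisors.ne_zero hsx h
  unfold classesOver
  rw [dif_pos h𝔞, Finset.mem_filter]
  refine ⟨Finset.mem_univ _, ?_⟩
  have hprinc : ClassGroup.mk0 ⟨Ideal.span {x}, hsx⟩ = 1 := (ClassGroup.mk0_eq_one_iff hsx).mpr ⟨x, rfl⟩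
  have hmul : ClassGroup.mk0 ⟨𝔞, h𝔞⟩ * ClassGroup.mk0 ⟨𝔟, h𝔟⟩ ^ 2 = 1 := by
    rw [← map_pow, ← map_mul, ← hprinc]
    congr 1
    exact Subtype.ext (by simp [h])
  rw [inv_pow]
  exact inv_eq_of_mul_eq_one_left hmul

end Bad

/-! ## 4. The count constant in `δ`-form -/

/-- **`8·3^{ω(T)}·8^{ω(6A)} ≤ C(δ)·(A·T)^δ`** for `A, T ≥ 1` (`3^ω ≤ 6^ω ≪ T^δ`; `8^ω ≤ (6^ω)² ≪ ((6A)^{δ/2})² = 6^δ A^δ`;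
the tree's `exists_six_pow_card_primeFactors_le`). -/
theorem exists_shapeCount_const {δ : ℝ} (hδ : 0 < δ) : ∃ C : ℝ, 1 ≤ C ∧ ∀ A T : ℕ, A ≠ 0 → T ≠ 0 →
    (8 : ℝ) * 3 ^ T.primeFactors.card * 8 ^ (6 * A).primeFactors.card ≤ C * ((A : ℝ) * T) ^ δ := by
  obtain ⟨M₁, hM₁, h₁⟩ := exists_six_pow_card_primeFactors_le hδ
  obtain ⟨M₂, hM₂, h₂⟩ := exists_six_pow_card_primeFactors_le (half_pos hδ)
  have h6 : (1 : ℝ) ≤ 6 ^ δ := Real.one_le_rpow (by norm_num) hδ.le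
  refine ⟨8 * M₁ * M₂ ^ 2 * 6 ^ δ, ?_, fun A T hA hT => ?_⟩
  · have : (1 : ℝ) ≤ M₂ ^ 2 := one_le_pow₀ hM₂
    nlinarith [mul_le_mul h6 this zero_le_one (by positivity), mul_nonneg (by positivity : (0:ℝ) ≤ M₁ - 1) (by positivity : (0 : ℝ) ≤ M₂ ^ 2 * 6 ^ δ)]
  have hA0 : (0 : ℝ) ≤ A := Nat.cast_nonneg A
  have hT0 : (0 : ℝ) ≤ T := Nat.cast_nonneg T
  have h6A : (6 * A : ℕ) ≠ 0 := by omega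
  -- `3^{ω(T)} ≤ M₁ T^δ`
  have e₁ : (3 : ℝ) ^ T.primeFactors.card ≤ M₁ * (T : ℝ) ^ δ :=
    (pow_le_pow_left₀ (by norm_num) (by norm_num : (3 : ℝ) ≤ 6) _).trans (h₁ T hT)
  -- `8^{ω(6A)} ≤ (6^{ω(6A)})² ≤ (M₂ (6A)^{δ/2})² = M₂² 6^δ A^δ`
  have e₂ : (8 : ℝ) ^ (6 * A).primeFactors.card ≤ M₂ ^ 2 * 6 ^ δ * (A : ℝ) ^ δ := by
    have h36 : (8 : ℝ) ^ (6 * A).primeFactors.card ≤ ((6 : ℝ) ^ (6 * A).primeFactors.card) ^ 2 := by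
      rw [← pow_mul, pow_mul']
      exact pow_le_pow_left₀ (by norm_num) (by norm_num) _
    have hsq : ((6 : ℝ) ^ (6 * A).primeFactors.card) ^ 2 ≤ (M₂ * ((6 * A : ℕ) : ℝ) ^ (δ / 2)) ^ 2 :=
      pow_le_pow_left₀ (by positivity) (h₂ (6 * A) h6A) 2
    have hcalc : (M₂ * ((6 * A : ℕ) : ℝ) ^ (δ / 2)) ^ 2 = M₂ ^ 2 * 6 ^ δ * (A : ℝ) ^ δ := by
      rw [mul_pow, ← Real.rpow_natCast (((6 * A : ℕ) : ℝ) ^ (δ / 2)) 2, ← Real.rpow_mul (by positivity),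
        show δ / 2 * ((2 : ℕ) : ℝ) = δ by push_cast; ring, Nat.cast_mul, Nat.cast_ofNat,
        Real.mul_rpow (by norm_num) hA0]
      ring
    exact h36.trans (hsq.trans hcalc.le)
  have hAT : ((A : ℝ) * T) ^ δ = (A : ℝ) ^ δ * (T : ℝ) ^ δ := Real.mul_rpow hA0 hT0
  rw [hAT]
  have hTδ : (0 : ℝ) ≤ (T : ℝ) ^ δ := by positivity
  have hAδ : (0 : ℝ) ≤ (A : ℝ) ^ δ := by positivity
  calc (8 : ℝ) * 3 ^ T.primeFactors.card * 8 ^ (6 * A).primeFactors.card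
      ≤ 8 * (M₁ * (T : ℝ) ^ δ) * (M₂ ^ 2 * 6 ^ δ * (A : ℝ) ^ δ) :=
        mul_le_mul (mul_le_mul_of_nonneg_left e₁ (by norm_num)) e₂ (by positivity) (by positivity)
    _ = 8 * M₁ * M₂ ^ 2 * 6 ^ δ * ((A : ℝ) ^ δ * (T : ℝ) ^ δ) := by ring

/-- **At most three primes over a rational prime** (registered sub-goal `primesAbove_le_three` of stmt-ABC-1975): for
an irreducible maximal `F` and a prime `p`, at most three prime ideals of `R(F)` contain `p`. -/
theorem primesAbove_le_three : ∀ (F : BinaryCubic ℤ), F.IsIrreducible → RingOfForm.IsMaximal F → ∀ p : ℕ, p.Prime → {P : Ideal (RingOfForm F) | P.IsPrime ∧ (p : RingOfForm F) ∈ P}.ncard ≤ 3 := by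
  intro F hirr hmax p hp
  haveI : Fact F.IsIrreducible := ⟨hirr⟩
  haveI : Fact (RingOfForm.IsMaximal F) := ⟨hmax⟩
  have hset : {P : Ideal (RingOfForm F) | P.IsPrime ∧ (p : RingOfForm F) ∈ P} = ↑(primesAbove F p) := by
    ext P
    rw [Set.mem_setOf_eq, Finset.mem_coe, mem_primesAbove hp.ne_zero]
  rw [hset, Set.ncard_coe_finset]
  exact card_primesAbove_le_three hp

end Summit.ABC.ABC.Theorems.SharpModerateLaw.UnitPlane

end
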